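import Summits.AnomalousDissipation.AnomalousDissipation.Theses.NeutralTaylorWaves
import Summits.AnomalousDissipation.AnomalousDissipation.Theorems.NonresonantSelection.Negative.BorderedTestVectors
import Literature.Analysis.FunctionSpaces.TorusConvectionLaplacianNormSq
import Literature.Analysis.FluidPDE.CompressibleEulerLinearizedDerivative

/-!
# Negative lemmas for crux `NeutralTaylorWaves.NonresonantSelection` (stmt-AnomalousDissipation-16294):
# the translation mode and the phase border

The consequent of the crux (`NonresonantTaylorWaves`, last clause) asks for the BORDERED a-priori
bound `‖v‖₂² + b² ≤ M²(‖L_{w,c}(v,r) − b∂₃w‖₂² + ⟨v,∂₃w⟩²)`, `M = C₀ν^{-K₀}`, over smooth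
divergence-free mean-zero `v`, smooth `r`, real `b`, where
`L_{w,c}(v,r) = (w·∇)v + (v·∇)w − νΔv + ∇r − c∂₃v` is the linearised steady operator at the
quasi-steady state `(w, q, c)`. This file records, kernel-checked, WHY the phase border `⟨v,∂₃w⟩²`
is there and what deleting it costs (cdisprove cycle 1, 2026-08-17):

* `linearisation_partialDeriv_eq` — the **translation identity**: for smooth `w, q` and ANY
  coordinate direction `i`,
  `L_{w,c}(∂ᵢw, ∂ᵢq) = ∂ᵢ[(w·∇)w − νΔw + ∇q − c∂₃w]` pointwise (Leibniz for `(w·∇)w`, Schwarz for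
  `Δ`, `∇`, `∂₃`). So `∂ᵢw` is an exact kernel vector of the linearisation at every exact steady
  state of a force invariant under `xᵢ`-translations, and an `O(‖∂ᵢR‖₂)`-quasimode at a
  quasi-steady state with residual `R` of such a force.
* `unbordered_one_le` — test triples `(0,0,1)` and `(∂₃w, ∂₃q, 0)`: if the UN-bordered bound
  (the consequent's clause with the border term `⟨v,∂₃w⟩²` deleted) holds at `(w, c)` with
  constant `M`, then `1 ≤ M⁴ ∫‖∂₃[(w·∇)w − νΔw + ∇q − c∂₃w]‖²`; for an `x₃`-invariant force this
  is `1 ≤ M⁴‖∂₃R‖₂²` (`unbordered_one_le_residual`): an un-bordered polynomial bound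
  `M = C₀ν^{-K₀}` is INCOMPATIBLE with `C¹`-quasi-steadiness beyond order `ν^{2K₀}` — the natural
  strengthening "nonresonant" (instead of "nonresonant modulo the x₃-phase") of the crux is false on
  the intended all-orders family, and
* `unbordered_false_of_steadyState` — at every EXACT smooth steady state of an `x₃`-invariant
  force the un-bordered bound fails for every `M` (the realised states of the route,
  `NewtonRealisation`, are of this kind).

Tree calculus used: `Torus.partialDeriv_convect_eq_add_convect`, `Torus.partialDeriv_laplacian_comm`,
`CompressibleEuler.partialDeriv_gradient_eq`, `CompressibleEuler.partialDeriv_divergence_eq`,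
`Torus.partialDeriv_comm`, `Torus.hasZeroMean_partialDeriv`, and `bordered_one_le` of the sibling
file `BorderedTestVectors`. [folklore]
-/

set_option linter.dupNamespace false

noncomputable section

namespace Summit.AnomalousDissipation.AnomalousDissipation.Theorems.NonresonantSelection.Negative

open MeasureTheory
open Literature.Analysis.FunctionSpaces
open Literature.Analysis.FluidPDE

/-- **Translation identity.** For smooth `w, q`, real `ν, c` and any coordinate direction `i`,
the linearised steady operator applied to the translation mode `(∂ᵢw, ∂ᵢq)` is the `i`-th partial
derivative of the steady map: `(w·∇)∂ᵢw + (∂ᵢw·∇)w − νΔ∂ᵢw + ∇∂ᵢq − c∂₃∂ᵢw = ∂ᵢ[(w·∇)w − νΔw + ∇q − c∂₃w]`.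
[folklore] -/
theorem linearisation_partialDeriv_eq {w : UnitAddTorus (Fin 3) → EuclideanSpace ℝ (Fin 3)}
    {q : UnitAddTorus (Fin 3) → ℝ} (hw : Torus.IsSmooth w) (hq : Torus.IsSmooth q) (ν c : ℝ)
    (i : Fin 3) (x : UnitAddTorus (Fin 3)) :
    Torus.convect w (Torus.partialDeriv i w) x + Torus.convect (Torus.partialDeriv i w) w x
        - ν • Torus.laplacian (Torus.partialDeriv i w) x
        + Torus.gradient (Torus.partialDeriv i q) x
        - c • Torus.partialDeriv (2 : Fin 3) (Torus.partialDeriv i w) x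
      = Torus.partialDeriv i (fun y => Torus.convect w w y - ν • Torus.laplacian w y
          + Torus.gradient q y - c • Torus.partialDeriv (2 : Fin 3) w y) x := by
  have hN : Torus.IsSmooth (Torus.convect w w) := hw.convect hw
  have hL : Torus.IsSmooth (ν • Torus.laplacian w) := hw.laplacian.smul ν
  have hG : Torus.IsSmooth (Torus.gradient q) := hq.gradient
  have hD : Torus.IsSmooth (c • Torus.partialDeriv (2 : Fin 3) w) := (hw.partialDeriv 2).smul c
  have hfun : (fun y => Torus.convect w w y - ν • Torus.laplacian w y
      + Torus.gradient q y - c • Torus.partialDeriv (2 : Fin 3) w y)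
      = Torus.convect w w + (-(ν • Torus.laplacian w)) + Torus.gradient q
          + (-(c • Torus.partialDeriv (2 : Fin 3) w)) := by
    funext y
    simp only [Pi.add_apply, Pi.neg_apply, Pi.smul_apply, sub_eq_add_neg]
  rw [hfun,
    Torus.partialDeriv_add (((hN.add hL.neg).add hG).isContDiff (by simp)) (hD.neg.isContDiff (by simp)),
    Torus.partialDeriv_add ((hN.add hL.neg).isContDiff (by simp)) (hG.isContDiff (by simp)),
    Torus.partialDeriv_add (hN.isContDiff (by simp)) (hL.neg.isContDiff (by simp))]
  simp only [Pi.add_apply]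
  have h1 : Torus.partialDeriv i (Torus.convect w w) x
      = Torus.convect w (Torus.partialDeriv i w) x + Torus.convect (Torus.partialDeriv i w) w x :=
    Torus.partialDeriv_convect_eq_add_convect hw hw i x
  have h2 : Torus.partialDeriv i (-(ν • Torus.laplacian w)) x
      = -(ν • Torus.laplacian (Torus.partialDeriv i w) x) := by
    rw [show (-(ν • Torus.laplacian w)) = fun y => -((ν • Torus.laplacian w) y) from rfl,
      Torus.partialDeriv_neg, Torus.partialDeriv_const_smul (hw.laplacian.isContDiff (by simp)),
      Pi.smul_apply, Torus.partialDeriv_laplacian_comm hw i x]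
  have h3 : Torus.partialDeriv i (Torus.gradient q) x = Torus.gradient (Torus.partialDeriv i q) x :=
    CompressibleEuler.partialDeriv_gradient_eq hq i x
  have h4 : Torus.partialDeriv i (-(c • Torus.partialDeriv (2 : Fin 3) w)) x
      = -(c • Torus.partialDeriv (2 : Fin 3) (Torus.partialDeriv i w) x) := by
    rw [show (-(c • Torus.partialDeriv (2 : Fin 3) w))
        = fun y => -((c • Torus.partialDeriv (2 : Fin 3) w) y) from rfl,
      Torus.partialDeriv_neg, Torus.partialDeriv_const_smul ((hw.partialDeriv 2).isContDiff (by simp)),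
      Pi.smul_apply, Torus.partialDeriv_comm hw i 2 x]
  rw [h1, h2, h3, h4]
  abel

/-- Partial derivatives of a smooth divergence-free field are divergence free (`∂ᵢ div = div ∂ᵢ`).
[folklore] -/
theorem isDivFree_partialDeriv {w : UnitAddTorus (Fin 3) → EuclideanSpace ℝ (Fin 3)}
    (hw : Torus.IsSmooth w) (hdiv : Torus.IsDivFree w) (i : Fin 3) :
    Torus.IsDivFree (Torus.partialDeriv i w) := by
  intro x
  rw [← CompressibleEuler.partialDeriv_divergence_eq hw i x]
  have h0 : Torus.divergence w = fun _ => (0 : ℝ) := funext hdiv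
  rw [h0]
  simp [Torus.partialDeriv, Torus.lineDeriv]

/-- **The phase border is load-bearing (test triples `(0,0,1)` and `(∂₃w, ∂₃q, 0)`).** If the
UN-bordered a-priori bound — the last clause of `NeutralTaylorWaves.NonresonantTaylorWaves` with
the border term `(∫⟪v, ∂₃w⟫)²` deleted — holds at a smooth divergence-free base `w` (any smooth
`q`, drift `c`, viscosity `ν`) with constant `M`, then
`1 ≤ M⁴ ∫ ‖∂₃[(w·∇)w − νΔw + ∇q − c∂₃w]‖²`: the translation mode `∂₃w` is controlled only through
the `x₃`-derivative of the steady map. [folklore] -/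
theorem unbordered_one_le {ν : ℝ} {w : UnitAddTorus (Fin 3) → EuclideanSpace ℝ (Fin 3)}
    {q : UnitAddTorus (Fin 3) → ℝ} {c M : ℝ} (hw : Torus.IsSmooth w) (hq : Torus.IsSmooth q)
    (hdiv : Torus.IsDivFree w)
    (h : ∀ (v : UnitAddTorus (Fin 3) → EuclideanSpace ℝ (Fin 3)) (r : UnitAddTorus (Fin 3) → ℝ) (b : ℝ),
      Torus.IsSmooth v → Torus.IsSmooth r → Torus.IsDivFree v → Torus.HasZeroMean v →
      MeasureTheory.integral MeasureTheory.volume (fun x => ‖v x‖ ^ 2) + b ^ 2 ≤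
        M ^ 2 * MeasureTheory.integral MeasureTheory.volume (fun x =>
          ‖Torus.convect w v x + Torus.convect v w x - ν • Torus.laplacian v x +
            Torus.gradient r x - c • Torus.partialDeriv (2 : Fin 3) v x -
            b • Torus.partialDeriv (2 : Fin 3) w x‖ ^ 2)) :
    1 ≤ M ^ 4 * MeasureTheory.integral MeasureTheory.volume (fun x =>
      ‖Torus.partialDeriv (2 : Fin 3) (fun y => Torus.convect w w y - ν • Torus.laplacian w y
          + Torus.gradient q y - c • Torus.partialDeriv (2 : Fin 3) w y) x‖ ^ 2) := by
  -- the un-bordered bound implies the bordered one, hence `1 ≤ M² ∫‖∂₃w‖²`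
  have hB : 1 ≤ M ^ 2 * MeasureTheory.integral MeasureTheory.volume
      (fun x => ‖Torus.partialDeriv (2 : Fin 3) w x‖ ^ 2) := by
    refine bordered_one_le (ν := ν) (w := w) (c := c) (M := M) fun v r b hv hr hvd hvm => ?_
    refine (h v r b hv hr hvd hvm).trans ?_
    exact mul_le_mul_of_nonneg_left (le_add_of_nonneg_right (sq_nonneg _)) (sq_nonneg M)
  -- the translation mode as a test field
  have key := h (Torus.partialDeriv (2 : Fin 3) w) (Torus.partialDeriv (2 : Fin 3) q) 0
    (hw.partialDeriv 2) (hq.partialDeriv 2) (isDivFree_partialDeriv hw hdiv 2)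
    (Torus.hasZeroMean_partialDeriv hw 2)
  have hid : (fun x => ‖Torus.convect w (Torus.partialDeriv (2 : Fin 3) w) x
        + Torus.convect (Torus.partialDeriv (2 : Fin 3) w) w x
        - ν • Torus.laplacian (Torus.partialDeriv (2 : Fin 3) w) x
        + Torus.gradient (Torus.partialDeriv (2 : Fin 3) q) x
        - c • Torus.partialDeriv (2 : Fin 3) (Torus.partialDeriv (2 : Fin 3) w) x
        - (0 : ℝ) • Torus.partialDeriv (2 : Fin 3) w x‖ ^ 2)
      = fun x => ‖Torus.partialDeriv (2 : Fin 3) (fun y => Torus.convect w w y - ν • Torus.laplacian w y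
          + Torus.gradient q y - c • Torus.partialDeriv (2 : Fin 3) w y) x‖ ^ 2 := by
    funext x
    rw [zero_smul, sub_zero, linearisation_partialDeriv_eq hw hq ν c 2 x]
  rw [hid] at key
  have key' : MeasureTheory.integral MeasureTheory.volume
        (fun x => ‖Torus.partialDeriv (2 : Fin 3) w x‖ ^ 2) ≤
      M ^ 2 * MeasureTheory.integral MeasureTheory.volume (fun x =>
        ‖Torus.partialDeriv (2 : Fin 3) (fun y => Torus.convect w w y - ν • Torus.laplacian w y
          + Torus.gradient q y - c • Torus.partialDeriv (2 : Fin 3) w y) x‖ ^ 2) := by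
    simpa using key
  calc (1 : ℝ) ≤ M ^ 2 * MeasureTheory.integral MeasureTheory.volume
        (fun x => ‖Torus.partialDeriv (2 : Fin 3) w x‖ ^ 2) := hB
    _ ≤ M ^ 2 * (M ^ 2 * MeasureTheory.integral MeasureTheory.volume (fun x =>
        ‖Torus.partialDeriv (2 : Fin 3) (fun y => Torus.convect w w y - ν • Torus.laplacian w y
          + Torus.gradient q y - c • Torus.partialDeriv (2 : Fin 3) w y) x‖ ^ 2)) :=
      mul_le_mul_of_nonneg_left key' (sq_nonneg M)
    _ = _ := by ring

/-- **Residual form.** With a smooth force `f` that is invariant under `x₃`-translations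
(`∂₃f ≡ 0`) and the steady residual `R := (w·∇)w − νΔw + ∇q − c∂₃w − f` of the crux, the
un-bordered bound with constant `M` forces `1 ≤ M⁴‖∂₃R‖₂²`: an un-bordered polynomial bound
`M = C₀ν^{-K₀}` is incompatible with `‖∂₃R‖₂ = o(ν^{2K₀})`, in particular with all-orders
quasi-steadiness in `C¹`. [folklore] -/
theorem unbordered_one_le_residual {ν : ℝ} {w f : UnitAddTorus (Fin 3) → EuclideanSpace ℝ (Fin 3)}
    {q : UnitAddTorus (Fin 3) → ℝ} {c M : ℝ} (hw : Torus.IsSmooth w) (hq : Torus.IsSmooth q)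
    (hf : Torus.IsSmooth f) (hdiv : Torus.IsDivFree w)
    (hf3 : ∀ x, Torus.partialDeriv (2 : Fin 3) f x = 0)
    (h : ∀ (v : UnitAddTorus (Fin 3) → EuclideanSpace ℝ (Fin 3)) (r : UnitAddTorus (Fin 3) → ℝ) (b : ℝ),
      Torus.IsSmooth v → Torus.IsSmooth r → Torus.IsDivFree v → Torus.HasZeroMean v →
      MeasureTheory.integral MeasureTheory.volume (fun x => ‖v x‖ ^ 2) + b ^ 2 ≤
        M ^ 2 * MeasureTheory.integral MeasureTheory.volume (fun x =>
          ‖Torus.convect w v x + Torus.convect v w x - ν • Torus.laplacian v x +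
            Torus.gradient r x - c • Torus.partialDeriv (2 : Fin 3) v x -
            b • Torus.partialDeriv (2 : Fin 3) w x‖ ^ 2)) :
    1 ≤ M ^ 4 * MeasureTheory.integral MeasureTheory.volume (fun x =>
      ‖Torus.partialDeriv (2 : Fin 3) (fun y => Torus.convect w w y - ν • Torus.laplacian w y
          + Torus.gradient q y - c • Torus.partialDeriv (2 : Fin 3) w y - f y) x‖ ^ 2) := by
  have h1 := unbordered_one_le hw hq hdiv h
  have hS : Torus.IsSmooth (fun y => Torus.convect w w y - ν • Torus.laplacian w y
      + Torus.gradient q y - c • Torus.partialDeriv (2 : Fin 3) w y) :=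
    (((hw.convect hw).sub (hw.laplacian.smul ν)).add hq.gradient).sub ((hw.partialDeriv 2).smul c)
  have hsplit : (fun y => Torus.convect w w y - ν • Torus.laplacian w y
      + Torus.gradient q y - c • Torus.partialDeriv (2 : Fin 3) w y - f y)
      = (fun y => Torus.convect w w y - ν • Torus.laplacian w y
          + Torus.gradient q y - c • Torus.partialDeriv (2 : Fin 3) w y) + (-f) := by
    funext y
    simp only [Pi.add_apply, Pi.neg_apply, sub_eq_add_neg]
  have hpt : ∀ x, Torus.partialDeriv (2 : Fin 3) (fun y => Torus.convect w w y - ν • Torus.laplacian w y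
      + Torus.gradient q y - c • Torus.partialDeriv (2 : Fin 3) w y - f y) x
      = Torus.partialDeriv (2 : Fin 3) (fun y => Torus.convect w w y - ν • Torus.laplacian w y
      + Torus.gradient q y - c • Torus.partialDeriv (2 : Fin 3) w y) x := by
    intro x
    rw [hsplit, Torus.partialDeriv_add (hS.isContDiff (by simp)) (hf.neg.isContDiff (by simp)),
      Pi.add_apply, show (-f) = fun y => -(f y) from rfl, Torus.partialDeriv_neg, hf3, neg_zero,
      add_zero]
  simp_rw [hpt]
  exact h1

/-- **The un-bordered bound is false at every exact steady state of an `x₃`-invariant force**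
(test triples `(0,0,1)` and `(∂₃w, ∂₃q, 0)`: `∂₃w` is an exact kernel vector of the
linearisation, and it is the only handle on the drift column). Any proof of the crux must use the
phase border `⟨v, ∂₃w⟩²`; the realised states of the route are exactly of this kind. [folklore] -/
theorem unbordered_false_of_steadyState {ν : ℝ} {w f : UnitAddTorus (Fin 3) → EuclideanSpace ℝ (Fin 3)}
    {q : UnitAddTorus (Fin 3) → ℝ} {c : ℝ} (hw : Torus.IsSmooth w) (hq : Torus.IsSmooth q)
    (hdiv : Torus.IsDivFree w)
    (hsteady : ∀ x, Torus.convect w w x - ν • Torus.laplacian w x + Torus.gradient q x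
      - c • Torus.partialDeriv (2 : Fin 3) w x = f x)
    (hf3 : ∀ x, Torus.partialDeriv (2 : Fin 3) f x = 0) (M : ℝ) :
    ¬ (∀ (v : UnitAddTorus (Fin 3) → EuclideanSpace ℝ (Fin 3)) (r : UnitAddTorus (Fin 3) → ℝ) (b : ℝ),
      Torus.IsSmooth v → Torus.IsSmooth r → Torus.IsDivFree v → Torus.HasZeroMean v →
      MeasureTheory.integral MeasureTheory.volume (fun x => ‖v x‖ ^ 2) + b ^ 2 ≤
        M ^ 2 * MeasureTheory.integral MeasureTheory.volume (fun x =>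
          ‖Torus.convect w v x + Torus.convect v w x - ν • Torus.laplacian v x +
            Torus.gradient r x - c • Torus.partialDeriv (2 : Fin 3) v x -
            b • Torus.partialDeriv (2 : Fin 3) w x‖ ^ 2)) := by
  intro h
  have h1 := unbordered_one_le hw hq hdiv h
  have hS : (fun y => Torus.convect w w y - ν • Torus.laplacian w y
      + Torus.gradient q y - c • Torus.partialDeriv (2 : Fin 3) w y) = f := funext hsteady
  rw [hS] at h1
  simp only [hf3, norm_zero, ne_eq, OfNat.ofNat_ne_zero, not_false_eq_true, zero_pow,
    integral_zero, mul_zero] at h1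
  exact absurd h1 (by norm_num)

end Summit.AnomalousDissipation.AnomalousDissipation.Theorems.NonresonantSelection.Negative

end
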